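import Summits.QuantumAdvantage.QuantumAdvantage.Theses.SosSandwich
import Summits.QuantumAdvantage.QuantumAdvantage.Theorems.SosSandwichHomogeneousPBAATotalInfluence
import Summits.QuantumAdvantage.QuantumAdvantage.Theorems.SosSandwichPseudoBoundedClosureA
import Summits.QuantumAdvantage.QuantumAdvantage.Theorems.SosSandwichOneQueryFrameAA
import Literature.Computability.Complexity.BooleanFourier

/-!
# Route `SosSandwich`: the exponent of the T-lossy homogeneous rung `HomogeneousPBAAT` is at least `2`

`HomogeneousPBAAT` (support item stmt-QuantumAdvantage-27399; repair of the refuted rung `HomogeneousPBAA`,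
stmt-QuantumAdvantage-15241, and the intended re-typing of the dead stub `stub_homogeneousRung` of line `birth` of
the crux `PseudoBoundedAA`, stmt-QuantumAdvantage-15237) asks for `c : ℕ`, `C > 0` such that every pseudo-bounded
`p` of order `T ≥ 1` obeying the Laplacian eigen-equation `Σᵢ (p − p∘flipᵢ) = 4T (p − E p)` (level exactly `2T`)
has a variable with `Infᵢ[p] ≥ C·(Var[p]/T)^c`. The repair record (docstring of 27399; cell decomp-qadv, critic
PB26) calibrates it on the iterated address family only: "`c ≥ 1` forced, `c = 1` tight".

THIS FILE: `c = 1` (hence `c = 0`) is IMPOSSIBLE — every admissible pair has `c ≥ 2`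
(`homogeneousPBAAT_exponent_ge_two`, `homogeneousPBAAT_iff_exponent_ge_two`); `c = 2` is the idea card's sharp
prediction `maxInf ≥ C·Var²/T²`. Witness: the ONE-QUERY, TOP-HOMOGENEOUS member of `K_1`

  `p_N = m²`,  `m = (1/N) Σᵢ (1 − 2xᵢ)`  (Deutsch–Jozsa acceptance probability),

`1 − p_N = (1/2N²) Σ_{i,k} ((1−2xᵢ) − (1−2x_k))²` on the cube, `E p_N = 1/N`, `p_N − 1/N` on level `2`, EVERY
influence `16(N−1)/N⁴`, `Var = 2(N−1)/N³` (`MeanSquare.exists_meanSquare`, variance via the tree identity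
`Σᵢ Infᵢ = 8T·Var`). So `maxInf = (8/N)·Var` at the FIXED order `T = 1`: no `C` with `C·(Var/T)¹ ≤ maxInf`
survives `N > 8/C`. At `T = 1`, `c = 2` holds with `C = 4/9` by the proved support `OneQueryFrameAA`
(`homogeneousPBAAT_order_one`); on this family `maxInf ≍ Var^{3/2}`. Also: PB-AA with `(c, C)` gives the rung
with the same `(c, C)` (`homogeneousPBAAT_body_of_pseudoBoundedAA_body`, `ε := Var`) — the repaired rung can
only fail together with the crux — whence the crux's own exponent is `≥ 2` (`pseudoBoundedAA_exponent_ge_two`: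
the card's "`c = 2` forced by the one-query mean", kernel-checked).

Elementary cube bookkeeping (`Σₓ sgn(xᵢ) sgn(x_k) = 2^N [i = k]`); no named facts. [cite: EscuderoGutierrez2023, Thm. 1.6, Cor. 1.7]
[cite: ODonnell2014, §2.2–§2.3] [cite: AaronsonAmbainis2014, Conj. 6] [cite: KaniewskiLeeDewolf2015, Def. 7]
-/

set_option linter.dupNamespace false -- D-0017: single-problem summit ⇒ `QuantumAdvantage.QuantumAdvantage` by design

noncomputable section
namespace Summit.QuantumAdvantage.QuantumAdvantage.Theorems.SosSandwich

open Finset MvPolynomial Literature.Computability.QuantumComplexity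
open Literature.Probability.RandomGraphs.LowDegree (sgn walsh sgn_mul_self)
open Literature.Computability.Complexity.LowDegree (sum_walsh_mul_walsh_index)

namespace MeanSquare

variable {N : ℕ}

/-- Flipping bit `i` lowers `Σ_k sgn(x_k)` by `2 sgn(xᵢ)`. [folklore] -/
theorem sum_sgn_flipBit (i : Fin N) (x : Fin N → Bool) :
    ∑ k, sgn (flipBit i x k) = ∑ k, sgn (x k) - 2 * sgn (x i) := by
  have hdiff : ∑ k, (sgn (flipBit i x k) - sgn (x k)) = sgn (flipBit i x i) - sgn (x i) :=
    Finset.sum_eq_single i (fun k _ hk => by simp [flipBit, Function.update_of_ne hk]) (by simp)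
  have hi : sgn (flipBit i x i) = -sgn (x i) := by
    simp only [flipBit, Function.update_self]; cases x i <;> simp [sgn]
  rw [hi, Finset.sum_sub_distrib] at hdiff
  linarith

/-- Orthogonality of the degree-one characters: `Σₓ sgn(xᵢ) sgn(x_k) = 2^N [i = k]`. [cite: ODonnell2014, §1.4] -/
theorem sum_cube_sgn_mul_sgn (i k : Fin N) :
    ∑ x : Fin N → Bool, sgn (x i) * sgn (x k) = if i = k then (2 : ℝ) ^ N else 0 := by
  simpa only [walsh, Finset.prod_singleton, Finset.singleton_inj] using
    sum_walsh_mul_walsh_index ({i} : Finset (Fin N)) {k}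

/-- `Σₓ (Σ_k sgn(x_k))² = 2^N · N`. [cite: ODonnell2014, §1.4] -/
theorem sum_cube_sumSgn_sq : ∑ x : Fin N → Bool, (∑ k, sgn (x k)) ^ 2 = (2 : ℝ) ^ N * N := by
  calc ∑ x : Fin N → Bool, (∑ k, sgn (x k)) ^ 2
      = ∑ x : Fin N → Bool, ∑ i, ∑ k, sgn (x i) * sgn (x k) := by
        refine Finset.sum_congr rfl fun x _ => ?_
        rw [sq, Finset.sum_mul_sum]
    _ = ∑ i : Fin N, ∑ k : Fin N, ∑ x : Fin N → Bool, sgn (x i) * sgn (x k) := by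
        rw [Finset.sum_comm]
        exact Finset.sum_congr rfl fun i _ => Finset.sum_comm
    _ = ∑ i : Fin N, ∑ k : Fin N, (if i = k then (2 : ℝ) ^ N else 0) := by
        simp_rw [sum_cube_sgn_mul_sgn]
    _ = ∑ _i : Fin N, (2 : ℝ) ^ N := by
        refine Finset.sum_congr rfl fun i _ => ?_
        rw [Finset.sum_ite_eq]; simp
    _ = (2 : ℝ) ^ N * N := by
        rw [Finset.sum_const, Finset.card_univ, Fintype.card_fin, nsmul_eq_mul, mul_comm]

/-- `Σₓ (Σ_k sgn(x_k)) · sgn(xᵢ) = 2^N`. [cite: ODonnell2014, §1.4] -/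
theorem sum_cube_sumSgn_mul_sgn (i : Fin N) :
    ∑ x : Fin N → Bool, (∑ k, sgn (x k)) * sgn (x i) = (2 : ℝ) ^ N := by
  calc ∑ x : Fin N → Bool, (∑ k, sgn (x k)) * sgn (x i)
      = ∑ x : Fin N → Bool, ∑ k, sgn (x k) * sgn (x i) := by
        refine Finset.sum_congr rfl fun x _ => ?_
        rw [Finset.sum_mul]
    _ = ∑ k : Fin N, ∑ x : Fin N → Bool, sgn (x k) * sgn (x i) := Finset.sum_comm
    _ = ∑ k : Fin N, (if k = i then (2 : ℝ) ^ N else 0) := by simp_rw [sum_cube_sgn_mul_sgn]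
    _ = (2 : ℝ) ^ N := by rw [Finset.sum_ite_eq']; simp

/-- `1 − 2xᵢ` evaluates to the sign of the `i`-th bit. [folklore] -/
theorem evalBool_affine (i : Fin N) (x : Fin N → Bool) :
    evalBool (1 - C 2 * X i : MvPolynomial (Fin N) ℝ) x = sgn (x i) := by
  unfold evalBool
  simp only [map_sub, map_one, map_mul, eval_C, eval_X]
  cases x i <;> norm_num [sgn]

/-- `1 − 2xᵢ` has total degree `≤ 1`. [folklore] -/
theorem totalDegree_affine_le (i : Fin N) : (1 - C 2 * X i : MvPolynomial (Fin N) ℝ).totalDegree ≤ 1 := by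
  refine (totalDegree_sub _ _).trans (max_le ?_ ((totalDegree_mul _ _).trans ?_))
  · simp [totalDegree_one]
  · simp [totalDegree_C, totalDegree_X]

/-- A difference of two of the affine forms has total degree `≤ 1`. [folklore] -/
theorem totalDegree_affine_sub_le (i k : Fin N) :
    ((1 - C 2 * X i) - (1 - C 2 * X k) : MvPolynomial (Fin N) ℝ).totalDegree ≤ 1 :=
  (totalDegree_sub _ _).trans (max_le (totalDegree_affine_le i) (totalDegree_affine_le k))

/-- **The mean-square (Deutsch–Jozsa) polynomial** `p = m²`, `m = (1/N) Σᵢ (1 − 2xᵢ)`, `N ≥ 1`: pseudo-bounded of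
order `1` (`1 − p = (1/2N²) Σ_{i,k} ((1−2xᵢ) − (1−2x_k))²` on the cube), `E p = 1/N`, Laplacian eigen-equation of
order `T = 1` (level `2`), every influence `16(N−1)/N⁴`, variance `2(N−1)/N³`. [cite: ODonnell2014, §2.2–§2.3] -/
theorem exists_meanSquare (N : ℕ) (hN : 1 ≤ N) : ∃ p : MvPolynomial (Fin N) ℝ,
    PseudoBounded 1 p ∧
    (∀ x, evalBool p x = (∑ k, sgn (x k)) ^ 2 / (N : ℝ) ^ 2) ∧
    boolAvg (evalBool p) = 1 / (N : ℝ) ∧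
    (∀ x, ∑ i, (evalBool p x - evalBool p (flipBit i x)) =
      4 * ((1 : ℕ) : ℝ) * (evalBool p x - boolAvg (evalBool p))) ∧
    (∀ i, influence i p = 16 * ((N : ℝ) - 1) / (N : ℝ) ^ 4) ∧
    boolVariance p = 2 * ((N : ℝ) - 1) / (N : ℝ) ^ 3 := by
  have hN0 : (N : ℝ) ≠ 0 := Nat.cast_ne_zero.mpr (by omega)
  -- the affine form `q₀ = (1/N) Σᵢ (1 − 2xᵢ)` and `p = q₀ · q₀`
  set L : MvPolynomial (Fin N) ℝ := ∑ k, (1 - C 2 * X k) with hL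
  set q₀ : MvPolynomial (Fin N) ℝ := C (1 / (N : ℝ)) * L with hq₀
  have hLev : ∀ x, evalBool L x = ∑ k, sgn (x k) := fun x => by
    rw [hL]; unfold evalBool; rw [map_sum]
    exact Finset.sum_congr rfl fun k _ => evalBool_affine k x
  have hLdeg : L.totalDegree ≤ 1 := by
    rw [hL]
    exact (totalDegree_finsetSum _ _).trans (Finset.sup_le fun k _ => totalDegree_affine_le k)
  have hq₀ev : ∀ x, evalBool q₀ x = (∑ k, sgn (x k)) / (N : ℝ) := fun x => by
    rw [hq₀]; unfold evalBool; rw [map_mul, eval_C]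
    change 1 / (N : ℝ) * evalBool L x = _
    rw [hLev x]; ring
  have hq₀deg : q₀.totalDegree ≤ 1 := by
    rw [hq₀]
    refine (totalDegree_mul _ _).trans ?_
    rw [totalDegree_C, zero_add]; exact hLdeg
  have hev : ∀ x, evalBool (q₀ * q₀) x = (∑ k, sgn (x k)) ^ 2 / (N : ℝ) ^ 2 := fun x => by
    unfold evalBool; rw [map_mul]
    change evalBool q₀ x * evalBool q₀ x = _
    rw [hq₀ev x]; ring
  refine ⟨q₀ * q₀, ?_, ?_⟩
  · -- pseudo-bounded of order 1
    rw [pseudoBounded_iff_cubeSOS]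
    refine ⟨(CubeSOS.sq q₀ hq₀deg).congr fun x => ?_, ?_⟩
    · unfold evalBool; rw [map_mul, sq]
    · -- `1 − m² = (1/2N²) Σ_i Σ_k (sgn xᵢ − sgn x_k)²`
      have hcert : CubeSOS 1 (fun x : Fin N → Bool => 1 / (2 * (N : ℝ) ^ 2) *
          ∑ i, ∑ k, evalBool ((1 - C 2 * X i) - (1 - C 2 * X k) : MvPolynomial (Fin N) ℝ) x ^ 2) :=
        CubeSOS.smul (by positivity) (CubeSOS.sum _ _ fun i _ =>
          CubeSOS.sum _ _ fun k _ => CubeSOS.sq _ (totalDegree_affine_sub_le i k))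
      refine hcert.congr fun x => ?_
      have hdiff : ∀ i k, evalBool ((1 - C 2 * X i) - (1 - C 2 * X k) : MvPolynomial (Fin N) ℝ) x ^ 2 =
          2 - 2 * (sgn (x i) * sgn (x k)) := by
        intro i k
        unfold evalBool
        rw [map_sub]
        change (evalBool (1 - C 2 * X i) x - evalBool (1 - C 2 * X k) x) ^ 2 = _
        rw [evalBool_affine, evalBool_affine]
        have hi := sgn_mul_self (x i)
        have hk := sgn_mul_self (x k)
        linear_combination hi + hk
      set s : ℝ := ∑ k, sgn (x k) with hs
      have hsum : ∑ i, ∑ k, evalBool ((1 - C 2 * X i) - (1 - C 2 * X k) : MvPolynomial (Fin N) ℝ) x ^ 2 =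
          2 * (N : ℝ) * N - 2 * s ^ 2 := by
        have e1 : ∀ i : Fin N, ∑ k : Fin N, (2 - 2 * (sgn (x i) * sgn (x k))) =
            2 * (N : ℝ) - 2 * (sgn (x i) * s) := by
          intro i
          rw [Finset.sum_sub_distrib, Finset.sum_const, Finset.card_univ, Fintype.card_fin, nsmul_eq_mul,
            ← Finset.mul_sum, ← Finset.mul_sum, ← hs]
          ring
        simp_rw [hdiff, e1]
        rw [Finset.sum_sub_distrib, Finset.sum_const, Finset.card_univ, Fintype.card_fin, nsmul_eq_mul,
          ← Finset.mul_sum, ← Finset.sum_mul, ← hs]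
        ring
      rw [hev x, hsum]
      field_simp
      rw [hs]
  -- mean, Laplacian, influences, variance
  have havg : boolAvg (evalBool (q₀ * q₀)) = 1 / (N : ℝ) := by
    unfold boolAvg
    simp_rw [hev]
    rw [← Finset.sum_div, sum_cube_sumSgn_sq]
    field_simp
  -- pointwise: the flip difference is `4 (s·sgn xᵢ − 1)/N²`
  have hflip : ∀ x i, evalBool (q₀ * q₀) x - evalBool (q₀ * q₀) (flipBit i x) =
      4 * ((∑ k, sgn (x k)) * sgn (x i) - 1) / (N : ℝ) ^ 2 := by
    intro x i
    rw [hev, hev, sum_sgn_flipBit, div_sub_div_same]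
    congr 1
    have ha := sgn_mul_self (x i)
    linear_combination (-4 : ℝ) * ha
  have hLap : ∀ x, ∑ i, (evalBool (q₀ * q₀) x - evalBool (q₀ * q₀) (flipBit i x)) =
      4 * ((1 : ℕ) : ℝ) * (evalBool (q₀ * q₀) x - boolAvg (evalBool (q₀ * q₀))) := by
    intro x
    simp_rw [hflip x]
    rw [havg, hev, Nat.cast_one, ← Finset.sum_div]
    have e : ∑ i, 4 * ((∑ k, sgn (x k)) * sgn (x i) - 1) = 4 * (∑ k, sgn (x k)) ^ 2 - 4 * (N : ℝ) := by
      rw [← Finset.mul_sum, Finset.sum_sub_distrib, Finset.sum_const, Finset.card_univ, Fintype.card_fin,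
        nsmul_eq_mul, mul_one, ← Finset.mul_sum]
      ring
    rw [e]
    field_simp
  have hInf : ∀ i, influence i (q₀ * q₀) = 16 * ((N : ℝ) - 1) / (N : ℝ) ^ 4 := by
    intro i
    unfold influence boolAvg
    have hpt : ∀ x, (evalBool (q₀ * q₀) x - evalBool (q₀ * q₀) (flipBit i x)) ^ 2 =
        16 / (N : ℝ) ^ 4 * ((∑ k, sgn (x k)) ^ 2 - 2 * ((∑ k, sgn (x k)) * sgn (x i)) + 1) := by
      intro x
      rw [hflip x i]
      have ha := sgn_mul_self (x i)
      field_simp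
      linear_combination (16 * (∑ k, sgn (x k)) ^ 2) * ha
    simp_rw [hpt]
    rw [← Finset.mul_sum, Finset.sum_add_distrib, Finset.sum_sub_distrib, ← Finset.mul_sum,
      sum_cube_sumSgn_sq, sum_cube_sumSgn_mul_sgn, show ∑ _x : Fin N → Bool, (1 : ℝ) = (2 : ℝ) ^ N by simp]
    field_simp
    ring
  refine ⟨hev, havg, hLap, hInf, ?_⟩
  -- variance from the total-influence identity `Σᵢ Infᵢ = 8·1·Var`
  have htot := sum_influence_eq_of_laplacian 1 (q₀ * q₀) hLap
  simp_rw [hInf] at htot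
  rw [Finset.sum_const, Finset.card_univ, Fintype.card_fin, nsmul_eq_mul, Nat.cast_one, mul_one] at htot
  have h8 : boolVariance (q₀ * q₀) = (N : ℝ) * (16 * ((N : ℝ) - 1) / (N : ℝ) ^ 4) / 8 := by
    rw [htot]; ring
  rw [h8]
  field_simp
  ring

end MeanSquare

/-! ### The exponent of `HomogeneousPBAAT` -/

/-- **Any admissible exponent of `HomogeneousPBAAT` is at least `2`.** If `c : ℕ` and `C > 0` satisfy the body
of the route item `HomogeneousPBAAT` (stmt-QuantumAdvantage-27399) — every pseudo-bounded `p` of order `T ≥ 1`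
obeying the Laplacian eigen-equation of order `T` with `Var[p] > 0` has a variable with
`C·(Var[p]/T)^c ≤ Infᵢ[p]` — then `c ≥ 2`: for `c ≤ 1` the mean-square polynomials
`p_N = ((1/N)Σᵢ(1−2xᵢ))² ∈ K_1` (`MeanSquare.exists_meanSquare`: order `T = 1`, level `2`,
`Var = 2(N−1)/N³ ≤ 1`, every `Inf = 16(N−1)/N⁴`) would give `C·Var ≤ C·Var^c ≤ maxInf = (8/N)·Var`, false for
`N > 8/C`. So "c = 1 tight" of the repair record is superseded: `c ≥ 2` is forced (literal inline vocabulary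
of the route file). [cite: EscuderoGutierrez2023, Thm. 1.6, Cor. 1.7] [cite: AaronsonAmbainis2014, Conj. 6] -/
theorem homogeneousPBAAT_exponent_ge_two (c : ℕ) {C : ℝ} (hC : 0 < C)
    (h : ∀ (N T : ℕ) (p : MvPolynomial (Fin N) ℝ),
      let ev : MvPolynomial (Fin N) ℝ → (Fin N → Bool) → ℝ :=
        fun f x => MvPolynomial.eval (fun k => if x k then (1 : ℝ) else 0) f
      let avg : ((Fin N → Bool) → ℝ) → ℝ := fun g => (∑ x : Fin N → Bool, g x) / (2 : ℝ) ^ N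
      1 ≤ T →
      (∃ (m : ℕ) (q r : Fin m → MvPolynomial (Fin N) ℝ),
          (∀ j, (q j).totalDegree ≤ T ∧ (r j).totalDegree ≤ T) ∧
            ∀ x : Fin N → Bool, ev p x = ∑ j, ev (q j) x ^ 2 ∧ 1 - ev p x = ∑ j, ev (r j) x ^ 2) →
      (∀ x : Fin N → Bool, ∑ i : Fin N, (ev p x - ev p (Function.update x i (!x i))) =
          4 * (T : ℝ) * (ev p x - avg (ev p))) →
      0 < (avg fun x => (ev p x - avg (ev p)) ^ 2) →
      ∃ i : Fin N, C * ((avg fun x => (ev p x - avg (ev p)) ^ 2) / (T : ℝ)) ^ c ≤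
        (avg fun x => (ev p x - ev p (Function.update x i (!x i))) ^ 2)) :
    2 ≤ c := by
  by_contra hc
  push Not at hc
  -- a number of variables `N ≥ 2` with `N > 8/C`
  obtain ⟨n, hn⟩ := exists_nat_gt (8 / C)
  obtain ⟨p, hPB, -, -, hLap, hInf, hVar⟩ := MeanSquare.exists_meanSquare (n + 2) (by omega)
  have hN2 : (2 : ℝ) ≤ ((n + 2 : ℕ) : ℝ) := by exact_mod_cast (show 2 ≤ n + 2 by omega)
  set M : ℝ := ((n + 2 : ℕ) : ℝ) with hM
  have hM1 : 0 < M - 1 := by linarith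
  have hMpos : 0 < M := by linarith
  have hCM : 8 < C * M := by
    have h1 : 8 / C < M := hn.trans_le (by rw [hM]; exact_mod_cast Nat.le_add_right n 2)
    have := (div_lt_iff₀ hC).mp h1
    linarith [this]
  have hVpos : 0 < boolVariance p := by
    rw [hVar]; exact div_pos (mul_pos two_pos hM1) (pow_pos hMpos 3)
  obtain ⟨i, hi⟩ := h (n + 2) 1 p le_rfl hPB hLap hVpos
  change C * (boolVariance p / ((1 : ℕ) : ℝ)) ^ c ≤ influence i p at hi
  rw [Nat.cast_one, div_one, hVar, hInf] at hi
  -- `v := Var ∈ (0, 1]`, so `v ≤ v^c` for `c ≤ 1`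
  have hv1 : 2 * (M - 1) / M ^ 3 ≤ 1 := by
    rw [div_le_one (pow_pos hMpos 3)]
    have hMM : 4 ≤ M * M := by nlinarith
    have h4 : 4 * M ≤ M ^ 3 := by
      rw [pow_succ, pow_two]; exact mul_le_mul_of_nonneg_right hMM hMpos.le
    linarith
  have hpow : 2 * (M - 1) / M ^ 3 ≤ (2 * (M - 1) / M ^ 3) ^ c := by
    interval_cases c
    · rw [pow_zero]; exact hv1
    · rw [pow_one]
  have hle : C * (2 * (M - 1) / M ^ 3) ≤ 16 * (M - 1) / M ^ 4 :=
    (mul_le_mul_of_nonneg_left hpow hC.le).trans hi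
  rw [← mul_div_assoc, div_le_div_iff₀ (pow_pos hMpos 3) (pow_pos hMpos 4)] at hle
  -- hle : C (2(M−1)) M⁴ ≤ 16 (M−1) M³, i.e. (2CM − 16)(M−1)M³ ≤ 0
  have e : C * (2 * (M - 1)) * M ^ 4 - 16 * (M - 1) * M ^ 3 = (2 * C * M - 16) * ((M - 1) * M ^ 3) := by
    ring
  have hprod : 0 < (2 * C * M - 16) * ((M - 1) * M ^ 3) :=
    mul_pos (by linarith) (mul_pos hM1 (pow_pos hMpos 3))
  linarith [hle, hprod, e]

/-- **`HomogeneousPBAAT`, read with its forced exponent**: the route item (stmt-QuantumAdvantage-27399) holds iff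
it holds with some `c ≥ 2` (`homogeneousPBAAT_exponent_ge_two`). [cite: EscuderoGutierrez2023, Thm. 1.6, Cor. 1.7] -/
theorem homogeneousPBAAT_iff_exponent_ge_two :
    Summit.QuantumAdvantage.QuantumAdvantage.Theses.SosSandwich.HomogeneousPBAAT ↔
      ∃ (c : ℕ) (C : ℝ), 2 ≤ c ∧ 0 < C ∧ ∀ (N T : ℕ) (p : MvPolynomial (Fin N) ℝ),
        let ev : MvPolynomial (Fin N) ℝ → (Fin N → Bool) → ℝ :=
          fun f x => MvPolynomial.eval (fun k => if x k then (1 : ℝ) else 0) f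
        let avg : ((Fin N → Bool) → ℝ) → ℝ := fun g => (∑ x : Fin N → Bool, g x) / (2 : ℝ) ^ N
        1 ≤ T →
        (∃ (m : ℕ) (q r : Fin m → MvPolynomial (Fin N) ℝ),
            (∀ j, (q j).totalDegree ≤ T ∧ (r j).totalDegree ≤ T) ∧
              ∀ x : Fin N → Bool, ev p x = ∑ j, ev (q j) x ^ 2 ∧ 1 - ev p x = ∑ j, ev (r j) x ^ 2) →
        (∀ x : Fin N → Bool, ∑ i : Fin N, (ev p x - ev p (Function.update x i (!x i))) =
            4 * (T : ℝ) * (ev p x - avg (ev p))) →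
        0 < (avg fun x => (ev p x - avg (ev p)) ^ 2) →
        ∃ i : Fin N, C * ((avg fun x => (ev p x - avg (ev p)) ^ 2) / (T : ℝ)) ^ c ≤
          (avg fun x => (ev p x - ev p (Function.update x i (!x i))) ^ 2) := by
  constructor
  · rintro ⟨c, C, hC, h⟩
    exact ⟨c, C, homogeneousPBAAT_exponent_ge_two c hC h, hC, h⟩
  · rintro ⟨c, C, -, hC, h⟩
    exact ⟨c, C, hC, h⟩

/-- **The crux gives the repaired rung with the SAME constants**: `(c, C)` admissible for the body of
`PseudoBoundedAA` ⇒ admissible for the body of `HomogeneousPBAAT` (`ε := Var[p]`; homogeneity unused). So the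
T-lossy rung is a special case of PB-AA and cannot be refuted without refuting the crux (unlike the refuted
degree-free rung, stmt-QuantumAdvantage-15241). [cite: EscuderoGutierrez2023, Cor. 1.7] [cite: AaronsonAmbainis2014, Conj. 6] -/
theorem homogeneousPBAAT_body_of_pseudoBoundedAA_body (c : ℕ) (C : ℝ)
    (h : ∀ (N T : ℕ) (p : MvPolynomial (Fin N) ℝ) (ε : ℝ),
      let ev : MvPolynomial (Fin N) ℝ → (Fin N → Bool) → ℝ :=
        fun f x => MvPolynomial.eval (fun k => if x k then (1 : ℝ) else 0) f
      let avg : ((Fin N → Bool) → ℝ) → ℝ := fun g => (∑ x : Fin N → Bool, g x) / (2 : ℝ) ^ N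
      1 ≤ T →
      (∃ (m : ℕ) (q r : Fin m → MvPolynomial (Fin N) ℝ),
          (∀ j, (q j).totalDegree ≤ T ∧ (r j).totalDegree ≤ T) ∧
            ∀ x : Fin N → Bool, ev p x = ∑ j, ev (q j) x ^ 2 ∧ 1 - ev p x = ∑ j, ev (r j) x ^ 2) →
      0 < ε → ε ≤ (avg fun x => (ev p x - avg (ev p)) ^ 2) →
      ∃ i : Fin N, C * (ε / T) ^ c ≤ (avg fun x => (ev p x - ev p (Function.update x i (!x i))) ^ 2)) :
    ∀ (N T : ℕ) (p : MvPolynomial (Fin N) ℝ),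
      let ev : MvPolynomial (Fin N) ℝ → (Fin N → Bool) → ℝ :=
        fun f x => MvPolynomial.eval (fun k => if x k then (1 : ℝ) else 0) f
      let avg : ((Fin N → Bool) → ℝ) → ℝ := fun g => (∑ x : Fin N → Bool, g x) / (2 : ℝ) ^ N
      1 ≤ T →
      (∃ (m : ℕ) (q r : Fin m → MvPolynomial (Fin N) ℝ),
          (∀ j, (q j).totalDegree ≤ T ∧ (r j).totalDegree ≤ T) ∧
            ∀ x : Fin N → Bool, ev p x = ∑ j, ev (q j) x ^ 2 ∧ 1 - ev p x = ∑ j, ev (r j) x ^ 2) →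
      (∀ x : Fin N → Bool, ∑ i : Fin N, (ev p x - ev p (Function.update x i (!x i))) =
          4 * (T : ℝ) * (ev p x - avg (ev p))) →
      0 < (avg fun x => (ev p x - avg (ev p)) ^ 2) →
      ∃ i : Fin N, C * ((avg fun x => (ev p x - avg (ev p)) ^ 2) / (T : ℝ)) ^ c ≤
        (avg fun x => (ev p x - ev p (Function.update x i (!x i))) ^ 2) := by
  intro N T p ev avg hT hPB _ hV
  exact h N T p _ hT hPB hV le_rfl

/-- **Corollary: any admissible exponent of the crux `PseudoBoundedAA` is at least `2`** (the card's "`c = 2`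
forced by the one-query mean", kernel-checked: `maxInf = (8/N)·Var` in `K_1`). [cite: AaronsonAmbainis2014, Conj. 6] -/
theorem pseudoBoundedAA_exponent_ge_two (c : ℕ) {C : ℝ} (hC : 0 < C)
    (h : ∀ (N T : ℕ) (p : MvPolynomial (Fin N) ℝ) (ε : ℝ),
      let ev : MvPolynomial (Fin N) ℝ → (Fin N → Bool) → ℝ :=
        fun f x => MvPolynomial.eval (fun k => if x k then (1 : ℝ) else 0) f
      let avg : ((Fin N → Bool) → ℝ) → ℝ := fun g => (∑ x : Fin N → Bool, g x) / (2 : ℝ) ^ N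
      1 ≤ T →
      (∃ (m : ℕ) (q r : Fin m → MvPolynomial (Fin N) ℝ),
          (∀ j, (q j).totalDegree ≤ T ∧ (r j).totalDegree ≤ T) ∧
            ∀ x : Fin N → Bool, ev p x = ∑ j, ev (q j) x ^ 2 ∧ 1 - ev p x = ∑ j, ev (r j) x ^ 2) →
      0 < ε → ε ≤ (avg fun x => (ev p x - avg (ev p)) ^ 2) →
      ∃ i : Fin N, C * (ε / T) ^ c ≤ (avg fun x => (ev p x - ev p (Function.update x i (!x i))) ^ 2)) :
    2 ≤ c :=
  homogeneousPBAAT_exponent_ge_two c hC (homogeneousPBAAT_body_of_pseudoBoundedAA_body c C h)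

/-- **Order one: exponent `2` with constant `4/9`.** For `T = 1` the body of `HomogeneousPBAAT` holds with
`(c, C) = (2, 4/9)` (homogeneity unused) by the proved support `OneQueryFrameAA` (`4·Var² ≤ 9·maxInf` on `K_1`);
with `homogeneousPBAAT_exponent_ge_two`, at order one the admissible natural exponents are exactly `c ≥ 2`.
[cite: ODonnell2014, §1.4 and §2.2] [cite: KaniewskiLeeDewolf2015, Thm. 12] -/
theorem homogeneousPBAAT_order_one (N : ℕ) (p : MvPolynomial (Fin N) ℝ) :
    let ev : MvPolynomial (Fin N) ℝ → (Fin N → Bool) → ℝ :=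
      fun f x => MvPolynomial.eval (fun k => if x k then (1 : ℝ) else 0) f
    let avg : ((Fin N → Bool) → ℝ) → ℝ := fun g => (∑ x : Fin N → Bool, g x) / (2 : ℝ) ^ N
    (∃ (m : ℕ) (q r : Fin m → MvPolynomial (Fin N) ℝ),
        (∀ j, (q j).totalDegree ≤ 1 ∧ (r j).totalDegree ≤ 1) ∧
          ∀ x : Fin N → Bool, ev p x = ∑ j, ev (q j) x ^ 2 ∧ 1 - ev p x = ∑ j, ev (r j) x ^ 2) →
    0 < (avg fun x => (ev p x - avg (ev p)) ^ 2) →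
    ∃ i : Fin N, 4 / 9 * ((avg fun x => (ev p x - avg (ev p)) ^ 2) / ((1 : ℕ) : ℝ)) ^ 2 ≤
      (avg fun x => (ev p x - ev p (Function.update x i (!x i))) ^ 2) := by
  intro ev avg hPB hV
  obtain ⟨i, hi⟩ := OneQueryFrameAA_proof N p hPB hV
  refine ⟨i, ?_⟩
  rw [Nat.cast_one, div_one]
  change 4 * boolVariance p ^ 2 ≤ 9 * influence i p at hi
  change 4 / 9 * boolVariance p ^ 2 ≤ influence i p
  linarith

end Summit.QuantumAdvantage.QuantumAdvantage.Theorems.SosSandwich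
end
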